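import Literature.ModelTheory.ExponentialFields.Wilkie1989
import HarnessLib

/-!
# Wilkie 1996, §9: the Second Main Theorem reduced to the boundedness of non-singular zeros of exponential-polynomial systems

Trunk `TranscendEllArithS`, family `periods` (periods.S28): the top layer of the *printed* proof of
the Second Main Theorem of A. J. Wilkie, *Model completeness results for expansions of the ordered
field of real numbers by restricted Pfaffian functions and the exponential function*, J. Amer.
Math. Soc. 9 (1996) 1051–1094 — the named fact `Literature.ModelTheory.ExponentialFields.wilkie_isModelComplete`
(`RealExpField.lean`) — as it is organised in §9 of that paper (pp. 1083–1085), with page-precise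
named facts for its two printed ingredients and the glue between them proved.

§9, p. 1083: "Recall that this states that the theory of the structure `⟨ℝ̄, exp⟩` is model
complete. … by the brief discussion of model completeness in section 1, we must show that if
`k, K ⊨ T_exp` and `k` is a substructure of `K`, then any existential sentence with parameters
in `k` which is true in `K` is also true in `k`. … Now consider Theorem 7.2 in the case
`m = l = 1`, `C = ∅`, `H₁ = exp`, `K̃' = K` and `k̃' = k`. This result tells us that it is
sufficient to show that whenever `n ∈ ℕ` and `f₁, …, fₙ ∈ k[x₁, …, xₙ, exp(x₁), …, exp(xₙ)]` then
there exists `b ∈ k` such that if `ᾱ = ⟨α₁, …, αₙ⟩ ∈ Kⁿ` satisfies `f₁(ᾱ) = ⋯ = fₙ(ᾱ) = 0` and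
`J(f₁, …, fₙ)(ᾱ) ≠ 0` (where, as before, `J(f₁, …, fₙ)` denotes the determinant of the Jacobian
matrix `(∂fᵢ/∂xⱼ)`), then `|αᵢ| < b` for `i = 1, …, n`. (This reduction of the problem of proving
the model completeness of `⟨ℝ̄; exp⟩` was already established in [16] (Theorem 2).)"
(`[16]` = Wilkie, Illinois J. Math. 33 (1989), whose Theorem 2 is the named fact
`Literature.ModelTheory.ExponentialFields.Wilkie1989_existentiallyClosed_of_bounded` of `Wilkie1989.lean`.)

Contents (sorry-free, D-0014):

* `Literature.ModelTheory.ExponentialFields.RealExpModel.expPolyTerm`: the exponential term `p(ā; x̄, e^{x̄})` of a polynomial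
  `p(ā; X̄, Ȳ)` (a term of the language of ordered rings with parameters), i.e. an element of
  Wilkie's ring `k[x₁, …, xₙ, exp(x₁), …, exp(xₙ)]` presented by a polynomial; its value is
  `RealExpModel.expPolyEval` of `WilkieModelCompleteness.lean` (`realize_expPolyTerm`).
* `Literature.ModelTheory.ExponentialFields.RealExpModel.IsExpPolynomialPointOver f ᾱ`: `ᾱ ∈ Kⁿ` is a non-singular zero of a
  square system `f₁, …, fₙ ∈ k[x̄, e^{x̄}]` — the `(k̃, σ̄)`-definable points of Definition 2.5
  (p. 1058) in the unrestricted exponential case of §9 (by §6, p. 1070, there "`D_r(σ̄, K̃')` is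
  simply `K'^r`"), where the rings `M_r(k̃, K̃, σ̄)` of Definition 2.3 are the rings
  `k[x̄, exp(xᵢ) (i ∈ s)] ⊆ k[x̄, e^{x̄}]`.  Such a point is in particular an
  exponential-algebraic point in the sense of Wilkie 1989 (`isExpAlgebraicPointOver`, proved).
* `Literature.ModelTheory.ExponentialFields.Wilkie1996_expPolynomialPoints_bounded` (**named fact**, what §§9–11 establish,
  p. 1083 as quoted above together with `(*)ₘ`, p. 1084): every non-singular zero in `Kⁿ` of a
  square exponential-polynomial system over `k` has all its coordinates of absolute value `< b`
  for some `b ∈ k`.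
* `Literature.ModelTheory.ExponentialFields.Wilkie1996_thm7_2_exp` (**named fact**, Theorem 7.2, p. 1078, in the case `m = l = 1`,
  `C = ∅`, `H₁ = exp` of p. 1083): if all such points are bounded by elements of `k`, then
  existential formulas with parameters from `k` true in `K` are true in `k`.
* **Glue, proved**: `Literature.ModelTheory.ExponentialFields.wilkie_isModelComplete_of_thm7_2_exp` (the Second Main Theorem from
  the two named facts, by the proved Robinson test `Literature.ModelTheory.ModelCompleteness.robinsonTest_holds`);
  `Literature.ModelTheory.ExponentialFields.Wilkie1996_expPolynomialPoints_bounded_of_expAlgebraicPoints_bounded` (the printed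
  statement follows from the term version `Literature.ModelTheory.ExponentialFields.Wilkie1996_expAlgebraicPoints_bounded` of
  `Wilkie1989.lean`); and the converse direction *modulo unravelling of nested exponentials*
  (`Literature.ModelTheory.ExponentialFields.Wilkie1996_unravelling`, the implicit step behind Wilkie's parenthetical remark
  "(This reduction … was already established in [16] (Theorem 2))", stated here as a named
  fact to be discharged in `Wilkie1996Unravel.lean`):
  `Literature.ModelTheory.ExponentialFields.Wilkie1996_expAlgebraicPoints_bounded_of_unravelling`,
  `Literature.ModelTheory.ExponentialFields.Wilkie1996_thm7_2_exp_of_thm2`, and the assembly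
  `Literature.ModelTheory.ExponentialFields.wilkie_isModelComplete_of_thm2_of_unravelling_of_bounded`.

## The printed proof below these facts (for the record; not vendored here)

`Wilkie1996_expPolynomialPoints_bounded` is proved on pp. 1083–1085 and 1092–1094 by induction
on the number `m` of exponentials occurring (`(*)ₘ`, p. 1084), from: Proposition 9.2 (p. 1084;
(i) zero sets of `f ∈ Mˢₙ` contain non-singular zeros of square systems from `Mˢₙ` — Theorem 5.1;
(ii) isolated zeros are such — Theorem 4.9; (iii) square systems have finitely many non-singular
zeros — Khovanskii's Theorem 3.1 transferred), the model completeness of `T_e = Th(ℝ; e)`,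
`e(x) = exp((1 + x²)⁻¹)` (Example (A) p. 1053, a case of the First Main Theorem; Theorem 11.1,
p. 1091: "`T_e` is smooth and model complete", using van den Dries [13]), and 9.3 (p. 1084),
established in §11 from Theorems 10.3, 10.4 (`valdim ≤ dim` for smooth o-minimal theories),
Lemma 10.5 and Lemma 11.2.  `Wilkie1996_thm7_2_exp` is Theorem 7.2, proved in §7 from Lemma 2.8
(for the `T̃'` situation) and Lemma 2.7 (§5.2); for `T_exp` it is also Wilkie 1989, Theorem 2,
decomposed in `Wilkie1989.lean` (Lemma 3 and Corollary 1 proved in `Wilkie1989Lemma3Proofs.lean`;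
§§5–6 the named fact `Wilkie1989_expAlgebraicPoints_mem`).

## Status of `Wilkie1996_expPolynomialPoints_bounded` (split review, 2026-08-15)

The preceding section predates `Wilkie1996Induction.lean`, `Wilkie1996ValuationStep.lean` and
`Wilkie1996Lemma93Valuation.lean`; the position now is as follows (everything named is proved).

* **Equivalent to Wilkie's theorem.** `wilkie_isModelComplete_iff_expPolynomialPoints_bounded`
  (`WilkieModelCompletenessProofs.lean`: one direction by Wilkie 1989, Theorem 2, proved there as
  `Wilkie1989_existentiallyClosed_of_bounded_holds`; the other by Khovanskii finiteness
  transferred to the models of `T_exp`, Proposition 9.2 (iii)).  Hence this named fact,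
  `wilkie_isModelComplete` (`RealExpField.lean`), `Wilkie1996_realExp_modelsExistentiallyClosed`,
  `Wilkie1996_expPolynomial_transfer` (`WilkieModelCompleteness.lean`) and
  `Wilkie1996_expAlgebraicPoints_bounded` (`Wilkie1989.lean`;
  `Wilkie1996_expAlgebraicPoints_bounded_iff`, `Wilkie1996Unravel.lean`) are five presentations
  of one unproved theorem, and `wilkie_isOMinimal` is downstream of it
  (`wilkie_isOMinimal_of_expPolynomialPoints_bounded`, `RealExpOMinimalProofs.lean`).  The other
  two named facts of this file are discharged: `Wilkie1996_thm7_2_exp_holds`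
  (`WilkieModelCompletenessProofs.lean`), `Wilkie1996_unravelling_holds` (`Wilkie1996Unravel.lean`).
* **Reduced to the valuation inequality for `T_e`.** The induction of §9 (pp. 1084–1085) is
  proved with 9.3 (p. 1084; den Besten's condition (36)) as its only hypothesis
  (`Wilkie1996_expPolynomialPoints_bounded_of_lemma93`, `Wilkie1996Induction.lean`), and 9.3 is
  proved from the instances of the valuation inequality
  (`RealExpModel.lemma93_of_valuationInequality`,
  `Wilkie1996_expPolynomialPoints_bounded_of_valuationInequality`, `Wilkie1996ValuationStep.lean`;
  variant from a valuation-rank bound, with den Besten's Lemmas 7.2.2–7.2.3 proved,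
  `Wilkie1996_expPolynomialPoints_bounded_of_valRank`, `Wilkie1996Lemma93Valuation.lean`).
* **What remains** is exactly the hypothesis `hval` / `hVR` of those theorems: for models
  `k ⊆ K` of `T_exp` and a non-singular zero `ᾱ ∈ Kⁿ` of a square system from `Mˢₙ`, any
  `|s| + 1` of the elements `Σ νᵢ αᵢ`, `exp αᵢ` (`i ∈ s`) (resp. of a subfield containing
  `k`, `ᾱ_s`, `exp ᾱ_s`) are multiplicatively dependent over the integers modulo `k^×` times the
  units of the valuation ring of `K`.  Its printed proof (Wilkie, §§10–11; in detail M. den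
  Besten, *Wilkie's Theorem and the Uniform Real Schanuel Conjecture*, MSc thesis, Utrecht 2016,
  ch. 7) uses four ingredients, none of which exists in the tree in any form:
  (V1) the **First Main Theorem** in the case `exp↾[0,1]`, i.e. the model completeness of
  `T_e = Th(ℝ; exp((1 + x²)⁻¹))` (den Besten, Theorem 2.1.1, Lemma 6.2.3, Corollary 6.2.4,
  proved in chapters 2–5; Wilkie, §§2–8 and Theorem 11.1);
  (V2) the **o-minimality of `ℝ_an` and the Puiseux expansions at infinity of its definable unary
  functions** (van den Dries 1986; den Besten, Proposition 4.1.6 and Corollaries 4.1.7–4.1.8),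
  whence `T_e` is o-minimal and "smooth" (Theorem 7.2.1, whose condition S₂ uses (V1) again);
  (V3) the **valuation inequality** `valdim ≤ dim` for smooth o-minimal theories (Wilkie, §10;
  den Besten, Theorems 7.1.21–7.1.23, over the definable-closure, dimension and
  valuation-dimension apparatus of Definitions 7.1.1–7.1.19);
  (V4) the dimension count `dim Dcl_e(k, ᾱ, exp ᾱ_s) ≤ |s|` over `k` (den Besten, Claim in the
  proof of Lemma 7.2.4).
  (V1)–(V3) are distinct published theorems, each of the size of a theory, so this leaf cannot be
  discharged by inline lemmas; once (V1)–(V3) are vendored in the tree and `hval` is derived from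
  them through Lemma 6.2.3, Theorem 7.2.1 and Lemma 7.2.4, all five presentations above close by
  the one-line corollaries already proved.
* **Progress since the split review (2026-08-15, later the same day).**  The `e`-side of the
  printed proof is now in the tree, everything conditional on (V1) stated *as printed*, i.e. on
  the hypothesis `rexpTheory.IsModelComplete` (Wilkie's First Main Theorem for `exp↾[0,1]`,
  `RestrictedExp.lean`) or on its corollary `eTheory.IsModelComplete` (`ETheory.lean`):
  `DefinitionalExpansion.lean` (conservativity of definitional expansions), `ETheory.lean`
  (`T_e`, every `K ⊨ T_exp` is a model, `eEmbedding`), `ETermReduction.lean` /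
  `ExpTermReduction.lean` (existential formulas are projections of one exponential-term
  equation), `EOverRestrictedExp.lean` (`e` over `exp↾`, den Besten Lemma 6.2.3),
  `OMinimalOfModelComplete.lean` (model completeness + Khovanskii finiteness ⇒ o-minimality of
  *every* model, Wilkie 1996 §1), `EOMinimal.lean` / `ROMinimal.lean` / `ERestricted.lean`
  (o-minimality of `K | L_e` and `K | L_{exp↾}` for all `K ⊨ T_exp` and for `ℝ`; `k_e ≼ K_e`;
  `f(k) ≼ K | L_e` — den Besten Corollary 6.2.4 and the o-minimality clause of Theorem 7.2.1,
  here without `ℝ_an`), `EPolyNormalForm.lean` (den Besten's normal form (48) of `S₂`),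
  `RealExpansionModels.lean` and `RealClosedPolynomialPoints.lean` (abstract models of
  `Th(ℝ | L')` are real closed; den Besten Lemma 2.3.4 / Corollary 2.3.6 for real closed
  fields — the base case of any proof of (V1)).  On the valuation side the tree has the
  o-minimal structure theory over the models of `T_exp` (`OMinimalMonotonicity*.lean`,
  `OMinimalLimits.lean`, `OMinimalExtremeValue.lean`, `DefinableClosure*.lean`,
  `OMinimalPregeometry.lean`, …) and the conditional reductions `Wilkie1996DclClaim.lean`,
  `Wilkie1996DclValRank.lean`, whose single hypothesis `hV` (valuative rank of
  `Dcl_e(f(k) ∪ B)` over `f(k)` at most `|B|`) is what remains: it needs (V1) itself, the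
  polynomial boundedness of `T_e` (S₁ of Theorem 7.2.1, from (V2)) and (V3).

## Design choices

* As in `Wilkie1989.lean`: bundled models `Theory.ModelType.{0, 0, 0} realExpTheory`, embeddings
  `f : k ↪[Language.orderedExpRing] K` for "`k` is a substructure of `K`", and the formal
  Jacobian `RealExpModel.jacobian` (formal partial derivatives `RealExpModel.termPDeriv`, which
  realize to the true partial derivatives on `ℝ`, `RealExpModel.hasDerivAt_realize_termPDeriv`,
  hence, by transfer, to the derivatives "in the sense of `K`" of p. 1083).
* An element of `k[x₁, …, xₙ, exp(x₁), …, exp(xₙ)]` is presented by a polynomial: a term of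
  `Language.orderedRing` in the variables `k ⊕ (Fin n ⊕ Fin n)` (parameters; `X̄`; `Ȳ` standing
  for `e^{X̄}`), exactly as in `Wilkie1996_expPolynomial_transfer` (`WilkieModelCompleteness.lean`).
* Bounds are stated as printed, `|αᵢ| < b` with `b ∈ k` depending on the point (the form `(*)ₘ`
  of p. 1084 that the proof refutes; the hypothesis of Theorem 7.2 is likewise pointwise,
  "`-B < pᵢ < B (i = 1, …, r)` for some `B ∈ k'`"); `RealExpModel.isBoundedOver_iff_exists_abs_lt`
  relates them to `RealExpModel.IsBoundedOver` of `Wilkie1989.lean`.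

## References

* A. J. Wilkie, *Model completeness results for expansions of the ordered field of real numbers
  by restricted Pfaffian functions and the exponential function*, J. Amer. Math. Soc. 9 (1996),
  1051–1094: §2 (Definitions 2.1–2.5, pp. 1057–1059), Theorem 7.2 (p. 1078), §9 (pp. 1083–1085),
  Theorem 11.1 (p. 1091), §11 (pp. 1091–1094).
* A. J. Wilkie, *On the theory of the real exponential field*, Illinois J. Math. 33 (1989),
  384–408: Theorem 2.
-/

noncomputable section

open FirstOrder FirstOrder.Language FirstOrder.Language.Structure

namespace Literature.ModelTheory.ExponentialFields

namespace RealExpModel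

/-! ### Exponential polynomials as exponential terms -/

section ExpPoly

variable {κ : Type} {n : ℕ}

/-- The exponential term `p(ā; x̄, e^{x̄})` in the variables `x̄ = x₁, …, xₙ` (with parameters
`κ`) attached to a polynomial `p(ā; X̄, Ȳ)`, a term of the language of ordered rings in the
variables `κ ⊕ (Fin n ⊕ Fin n)`: transport `p` into the language of ordered exponential rings and
substitute `exp(xᵢ)` for `Yᵢ`.  These are (presentations of) the elements of Wilkie's ring
`k[x₁, …, xₙ, exp(x₁), …, exp(xₙ)]` (Wilkie 1996, §9, p. 1083; Definition 2.3, p. 1058, in the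
case `m = l = 1`, `H₁ = exp`). [cite: WilkieJAMS1996, §9, p. 1083] -/
def expPolyTerm (p : Language.orderedRing.Term (κ ⊕ (Fin n ⊕ Fin n))) :
    Language.orderedExpRing.Term (κ ⊕ Fin n) :=
  (orderedRingHomOrderedExpRing.onTerm p).subst
    (Sum.elim (fun c => var (Sum.inl c))
      (Sum.elim (fun i => var (Sum.inr i))
        (fun i => Language.orderedExpRing.termExp (var (Sum.inr i)))))

variable {K : Language.Theory.ModelType.{0, 0, 0} realExpTheory}

/-- The value of `expPolyTerm p` at `(ā; x̄)` is `p(ā; x̄, e^{x̄})` (the valuation `env` of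
`ExistentialReduction.lean`; equal to `RealExpModel.expPolyEval p a x` of
`WilkieModelCompleteness.lean` by `expPolyEval_eq`). [folklore] -/
@[simp] theorem realize_expPolyTerm (p : Language.orderedRing.Term (κ ⊕ (Fin n ⊕ Fin n)))
    (a : κ → K) (x : Fin n → K) :
    (expPolyTerm p).realize (Sum.elim a x) = p.realize (env a x) := by
  rw [expPolyTerm, Term.realize_subst, ← realize_onTerm (K := K) p (env a x)]
  congr 1
  funext v
  rcases v with c | i | i
  · rfl
  · rfl
  · simp [env]

end ExpPoly

/-! ### Non-singular zeros of exponential-polynomial systems and bounds -/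

section Points

variable {k K : Language.Theory.ModelType.{0, 0, 0} realExpTheory}

/-- `ᾱ ∈ Kⁿ` is a **non-singular zero of a square exponential-polynomial system over `k`**: for
some `f₁, …, fₙ ∈ k[x₁, …, xₙ, exp(x₁), …, exp(xₙ)]` (presented by polynomials `p₁, …, pₙ` over
`k`), `f₁(ᾱ) = ⋯ = fₙ(ᾱ) = 0` and `J(f₁, …, fₙ)(ᾱ) ≠ 0` (Wilkie 1996, §9, p. 1083).  These are
the `(k̃, σ̄)`-definable points of Definition 2.5 (p. 1058) for the unrestricted exponential
situation of §9 (where `D_r(σ̄, K) = Kʳ` by §6, p. 1070, and `M_r(k̃, K̃, σ̄) = k[x̄, exp(xᵢ) (i ∈ s)]`,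
Definitions 2.1–2.3, pp. 1057–1058).  The Jacobian is the formal one of `Wilkie1989.lean`. [cite: WilkieJAMS1996, Definition 2.5 and §9, p. 1083] -/
def IsExpPolynomialPointOver (f : k ↪[Language.orderedExpRing] K) {n : ℕ} (α : Fin n → K) : Prop :=
  ∃ p : Fin n → Language.orderedRing.Term (k ⊕ (Fin n ⊕ Fin n)),
    (∀ i, (expPolyTerm (p i)).realize (Sum.elim f α) = 0) ∧
      (jacobian (fun i => expPolyTerm (p i)) f α).det ≠ 0

/-- A non-singular zero of a square exponential-polynomial system over `k` is an
exponential-algebraic point over `k` in the sense of Wilkie 1989 (`IsExpAlgebraicPointOver`: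
non-singular zero of a square system of arbitrary exponential terms), the polynomials
`p(x̄, e^{x̄})` being particular terms. [cite: Wilkie1989, §1, p. 386] -/
theorem IsExpPolynomialPointOver.isExpAlgebraicPointOver {f : k ↪[Language.orderedExpRing] K}
    {n : ℕ} {α : Fin n → K} (h : IsExpPolynomialPointOver f α) : IsExpAlgebraicPointOver f α := by
  obtain ⟨p, hp0, hpJ⟩ := h
  exact ⟨fun i => expPolyTerm (p i), hp0, hpJ⟩

/-- Boundedness over `k` in the two printed forms: "there exist `a, b ∈ k` such that
`a < αᵢ < b`" (Wilkie 1989, Theorem 2; `IsBoundedOver`) iff "`|αᵢ| < b` (`i = 1, …, n`) for some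
`b ∈ k`" (Wilkie 1996, p. 1083). [folklore] -/
theorem isBoundedOver_iff_exists_abs_lt (f : k ↪[Language.orderedExpRing] K) {n : ℕ}
    (α : Fin n → K) : IsBoundedOver f α ↔ ∃ b : k, ∀ i, |α i| < f b := by
  constructor
  · rintro ⟨a, b, hab⟩
    refine ⟨max (-a) b, fun i => ?_⟩
    rw [abs_lt]
    constructor
    · have h1 : f (-max (-a) b) ≤ f a := by
        rw [map_le_iff]
        exact neg_le.1 (le_max_left _ _)
      rw [map_neg] at h1
      exact lt_of_le_of_lt h1 (hab i).1
    · have h2 : f b ≤ f (max (-a) b) := by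
        rw [map_le_iff]
        exact le_max_right _ _
      exact lt_of_lt_of_le (hab i).2 h2
  · rintro ⟨b, hb⟩
    refine ⟨-b, b, fun i => ?_⟩
    have h := abs_lt.1 (hb i)
    rw [map_neg]
    exact h

end Points

end RealExpModel

/-! ### The two printed ingredients of §9 and the glue -/

/-- **Wilkie 1996, the statement established in §§9–11** (§9, p. 1083, as the target of the
proof: "it is sufficient to show that whenever `n ∈ ℕ` and
`f₁, …, fₙ ∈ k[x₁, …, xₙ, exp(x₁), …, exp(xₙ)]` then there exists `b ∈ k` such that if
`ᾱ = ⟨α₁, …, αₙ⟩ ∈ Kⁿ` satisfies `f₁(ᾱ) = ⋯ = fₙ(ᾱ) = 0` and `J(f₁, …, fₙ)(ᾱ) ≠ 0` …, then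
`|αᵢ| < b` for `i = 1, …, n`").  Vendored in the **pointwise** form which the printed proof
establishes — it refutes `(*)ₘ`, p. 1084: "there exist `ᾱ = ⟨α₁, …, αₙ⟩ ∈ Kⁿ`, `l ∈ {1, …, n}`
… such that for some `f₁, …, fₙ ∈ Mˢₙ`, `f₁(ᾱ) = ⋯ = fₙ(ᾱ) = 0 ≠ J(f₁, …, fₙ)(ᾱ)`. Further,
`|α_l| > b` for all `b ∈ k`" (pp. 1084–1085, 1092–1094) — and which is the (pointwise) hypothesis
of Theorem 7.2 it feeds: for all models `k ⊆ K` of `T_exp = Th(ℝ; +, ·, −, 0, 1, exp, ≤)` (an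
embedding `f`), every non-singular zero `ᾱ ∈ Kⁿ` of a square exponential-polynomial system over
`k` satisfies `|αᵢ| < b` (`i = 1, …, n`) for some `b ∈ k`.  (The quoted form with `b` uniform in
`ᾱ` follows from this one by Proposition 9.2 (iii), p. 1084: such a system has only finitely many
non-singular zeros in `Kⁿ`; it is not needed for the Second Main Theorem.)  The printed proof
uses Proposition 9.2 (from Theorems 5.1, 4.9 and Khovanskii's Theorem 3.1), the model
completeness of `Th(ℝ; e)`, `e(x) = exp((1 + x²)⁻¹)` (First Main Theorem, Example (A) p. 1053;
Theorem 11.1 p. 1091) and 9.3 (p. 1084, established in §11 from Theorems 10.3, 10.4,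
Lemma 10.5 and Lemma 11.2).  **Status (2026-08-15):** equivalent in the tree to `wilkie_isModelComplete`
(`wilkie_isModelComplete_iff_expPolynomialPoints_bounded`, `WilkieModelCompletenessProofs.lean`) and
reduced to the valuation inequality for `T_e`
(`Wilkie1996_expPolynomialPoints_bounded_of_valuationInequality`, `Wilkie1996ValuationStep.lean`);
see the module documentation, § Status. [cite: WilkieJAMS1996, §9, p. 1083 (statement), (*)ₘ p. 1084, pp. 1084–1085 and 1092–1094 (proof)] -/
def Wilkie1996_expPolynomialPoints_bounded : Prop :=
  ∀ (k K : Language.Theory.ModelType.{0, 0, 0} realExpTheory) (f : k ↪[Language.orderedExpRing] K)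
    (n : ℕ) (α : Fin n → K),
    RealExpModel.IsExpPolynomialPointOver f α → ∃ b : k, ∀ i, |α i| < f b

/-- **Wilkie 1996, Theorem 7.2** (p. 1078) **in the case `m = l = 1`, `C = ∅`, `H₁ = exp`,
`K̃' = K`, `k̃' = k`** (p. 1083).  Theorem 7.2: "Let `H₁, …, H_l` be a Pfaffian chain of functions
on `ℝᵐ` … Let `k̃', K̃' ⊨ T̃'`, `k̃' ⊆ K̃'`, and suppose that for all `n, r ∈ ℕ` and all
`(n, r)`-sequences `σ̄`, every `(k̃', σ̄)`-definable point `⟨p₁, …, p_r⟩` of `(K')ʳ` satisfies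
`-B < pᵢ < B` (`i = 1, …, r`) for some `B ∈ k'`. … Then for any existential formula
`χ(x₁, …, x_e)` of `L̃'`, and any `a₁, …, a_e ∈ k'` we have `k̃' ⊨ χ(a₁, …, a_e)` if and only if
`K̃' ⊨ χ(a₁, …, a_e)`."  In the exponential case the definable points are the non-singular zeros
of square exponential-polynomial systems over `k` (`RealExpModel.IsExpPolynomialPointOver`; the
rings `M_r(k̃, K̃, σ̄)` being the subrings `k[x̄, exp(xᵢ) (i ∈ s)]` of `k[x̄, e^{x̄}]`), and the
conclusion is `k ≼₁ K` (`Literature.ModelTheory.UniversalTheories.PreservesUniversal`: universal formulas with parameters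
from `k` go up, equivalently existential ones come down; the other direction is automatic for an
embedding).  Wilkie, p. 1083: "(This reduction … was already established in [16] (Theorem 2).)",
i.e. Wilkie 1989, Theorem 2 (`Wilkie1989_existentiallyClosed_of_bounded`); see
`Wilkie1996_thm7_2_exp_of_thm2`. [cite: WilkieJAMS1996, Theorem 7.2 (p. 1078), specialised on p. 1083] -/
def Wilkie1996_thm7_2_exp : Prop :=
  ∀ (k K : Language.Theory.ModelType.{0, 0, 0} realExpTheory) (f : k ↪[Language.orderedExpRing] K),
    (∀ (n : ℕ) (α : Fin n → K),
        RealExpModel.IsExpPolynomialPointOver f α → ∃ B : k, ∀ i, -f B < α i ∧ α i < f B) →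
      UniversalTheories.PreservesUniversal Language.orderedExpRing f

/-- **The Second Main Theorem from Theorem 7.2 and the boundedness statement (proved glue)**:
the architecture of §9, p. 1083 ("This result tells us that it is sufficient to show that …"),
closed by Robinson's test (`Literature.ModelTheory.ModelCompleteness.robinsonTest_holds`; Wilkie, p. 1055). [cite: WilkieJAMS1996, §9, p. 1083] -/
theorem wilkie_isModelComplete_of_thm7_2_exp (h72 : Wilkie1996_thm7_2_exp)
    (hb : Wilkie1996_expPolynomialPoints_bounded) : wilkie_isModelComplete := by
  refine ModelCompleteness.robinsonTest_holds realExpTheory (fun k K f => h72 k K f ?_)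
  intro n α hα
  obtain ⟨b, hb'⟩ := hb k K f n α hα
  exact ⟨b, fun i => abs_lt.1 (hb' i)⟩

/-- The printed boundedness statement (exponential polynomials) follows from its version for
arbitrary exponential terms, `Wilkie1996_expAlgebraicPoints_bounded` of `Wilkie1989.lean`
(proved: an exponential polynomial is a term). [cite: WilkieJAMS1996, §9, p. 1083] -/
theorem Wilkie1996_expPolynomialPoints_bounded_of_expAlgebraicPoints_bounded
    (h : Wilkie1996_expAlgebraicPoints_bounded) : Wilkie1996_expPolynomialPoints_bounded := by
  intro k K f n α hα
  exact (RealExpModel.isBoundedOver_iff_exists_abs_lt f α).1 (h k K f n α hα.isExpAlgebraicPointOver)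

/-! ### Unravelling nested exponentials (the bridge to Wilkie 1989, Theorem 2) -/

/-- **Unravelling of nested exponentials** (a syntactic fact, implicit in Wilkie 1996: p. 1056,
"composite terms may be unravelled at the expense of introducing extra existentially quantified
variables", and p. 1083, "(This reduction … was already established in [16] (Theorem 2))", which
identifies the exponential-algebraic points of Wilkie 1989 — non-singular zeros of square systems
of arbitrary exponential *terms* over `k` — with projections of non-singular zeros of square
exponential-*polynomial* systems in more variables): every exponential-algebraic point `ᾱ ∈ Kⁿ`
over `k` extends to a non-singular zero `(ᾱ, β̄) ∈ Kⁿ⁺ᵐ` of a square exponential-polynomial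
system over `k` (name each exponentiated subterm `exp(t)` by new unknowns `z = t`, `y = exp(z)`;
the Jacobian determinant of the extended system at the extended point equals that of the
original one up to sign).  Stated here as a named fact; its proof (by induction on the number of
exponentials applied to non-variables) is the subject of `Wilkie1996Unravel.lean`. [folklore] -/
def Wilkie1996_unravelling : Prop :=
  ∀ (k K : Language.Theory.ModelType.{0, 0, 0} realExpTheory) (f : k ↪[Language.orderedExpRing] K)
    (n : ℕ) (α : Fin n → K),
    RealExpModel.IsExpAlgebraicPointOver f α →
      ∃ (m : ℕ) (β : Fin m → K), RealExpModel.IsExpPolynomialPointOver f (Fin.append α β)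

/-- Given unravelling, the printed boundedness statement for exponential-polynomial systems
yields the boundedness of all exponential-algebraic points (`Wilkie1996_expAlgebraicPoints_bounded`,
the hypothesis of Wilkie 1989, Theorem 2, for all models `k ⊆ K`): bound the extended point
`(ᾱ, β̄)` and forget `β̄`. [cite: WilkieJAMS1996, §9, p. 1083] -/
theorem Wilkie1996_expAlgebraicPoints_bounded_of_unravelling (hu : Wilkie1996_unravelling)
    (hb : Wilkie1996_expPolynomialPoints_bounded) : Wilkie1996_expAlgebraicPoints_bounded := by
  intro k K f n α hα
  obtain ⟨m, β, hαβ⟩ := hu k K f n α hα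
  obtain ⟨b, hb'⟩ := hb k K f (n + m) (Fin.append α β) hαβ
  refine (RealExpModel.isBoundedOver_iff_exists_abs_lt f α).2 ⟨b, fun i => ?_⟩
  have h := hb' (Fin.castAdd m i)
  rwa [Fin.append_left] at h

/-- **Theorem 7.2 (exponential case) from Wilkie 1989, Theorem 2**, given unravelling — the
content of Wilkie's remark "(This reduction … was already established in [16] (Theorem 2))"
(p. 1083): a pointwise bound on the non-singular zeros of exponential-polynomial systems bounds
every exponential-algebraic point, so Theorem 2 of Wilkie 1989 applies. [cite: WilkieJAMS1996, §9, p. 1083] -/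
theorem Wilkie1996_thm7_2_exp_of_thm2 (h₂ : Wilkie1989_existentiallyClosed_of_bounded)
    (hu : Wilkie1996_unravelling) : Wilkie1996_thm7_2_exp := by
  intro k K f hB
  refine h₂ k K f (fun n α hα => ?_)
  obtain ⟨m, β, hαβ⟩ := hu k K f n α hα
  obtain ⟨B, hB'⟩ := hB (n + m) (Fin.append α β) hαβ
  refine ⟨-B, B, fun i => ?_⟩
  have h := hB' (Fin.castAdd m i)
  rw [Fin.append_left] at h
  rw [RealExpModel.map_neg]
  exact h

/-- **Assembly (proved): Wilkie's theorem from Wilkie 1989, Theorem 2, unravelling, and the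
printed boundedness statement of §9** (Wilkie 1996, p. 1083; Robinson's test).  With
`Wilkie1989_thm2_of_mem` (`Wilkie1989Lemma3Proofs.lean`, Lemma 3 and Corollary 1 proved) the
remaining named facts below `wilkie_isModelComplete` on this line are
`Wilkie1989_expAlgebraicPoints_mem` (Wilkie 1989, §§5–6), `Wilkie1996_unravelling` and
`Wilkie1996_expPolynomialPoints_bounded` (Wilkie 1996, §§9–11). [cite: WilkieJAMS1996, §9, p. 1083] -/
theorem wilkie_isModelComplete_of_thm2_of_unravelling_of_bounded
    (h₂ : Wilkie1989_existentiallyClosed_of_bounded) (hu : Wilkie1996_unravelling)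
    (hb : Wilkie1996_expPolynomialPoints_bounded) : wilkie_isModelComplete :=
  wilkie_isModelComplete_of_thm7_2_exp (Wilkie1996_thm7_2_exp_of_thm2 h₂ hu) hb

end Literature.ModelTheory.ExponentialFields
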